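import Literature.NumberTheory.Automorphic.LocalOrbitalMeasureSemisimple
import HarnessLib

/-!
# The families of local orbital measures of an ANISOTROPIC unitary group at ALL rational classes (every rank, every finite place)
(Rogawski (1990), §4.9 p. 54, §14.2 p. 232; Deitmar–Echterhoff (2014), Thm. 1.5.3; Platonov–Rapinchuk (1994), §5.1)

Topic `NumberTheory/Automorphic`, namespace `Literature.NumberTheory.Automorphic.UnitaryGroup`.  THEOREMS ONLY (no def, no instance, no named fact, no
`sorry`).  Complement of ★ `LocalOrbitalMeasureSemisimple` (rank 3, SEMISIMPLE rational classes, every non-degenerate `H`) for the ANISOTROPIC inner forms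
`U(H)`, where NO semisimplicity ∕ regularity hypothesis and NO rank restriction is needed: the local group `U(H)(L⁺_v)` is unimodular (★
`modularCharacter_cmDatum_local_eq_one_of_anisotropic'`) and the local centraliser of every `γ_v = toLocal v (γ ⊗ 1)`, `γ` rational, is unimodular (★
`isMulRightInvariant_local_centralizer_toLocal_of_anisotropic`), so the generic constructor ★ `exists_orbitalMeasureFamily_of_isMulRightInvariant` (with ★
`isMulRightInvariant_centralizer_of_isConj` to pass to the representative `out c`) yields

* **`exists_localOrbitalMeasureFamily_of_anisotropic`**: `m : OrbitalMeasureFamily (U(H)(L⁺_v))`, non-zero, `U(H)(L⁺_v)`-invariant, regular and finite on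
  compact sets at every local class containing `toLocal v (γ ⊗ 1)` for some rational `γ` — the finite-place companion of ★ `exists_archOrbitalMeasureFamily_of_anisotropic`
  (place `∞`) and ★ `exists_adelicOrbitalMeasureFamily_admissible_of_anisotropic` (adelic);
* **`exists_localOrbitalMeasure_toLocal_of_anisotropic'`**: the single-class form with the REGULARITY of the measure and the quotient integral formula against
  ANY Haar measure of the centraliser recorded (★ `exists_smulInvariantMeasure_quotient_centralizer` verbatim).

## References
* J. Rogawski, *Automorphic Representations of Unitary Groups in Three Variables* (1990), §4.9 p. 54, §14.2 p. 232 [Rogawski1990].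
* A. Deitmar, S. Echterhoff, *Principles of Harmonic Analysis*, 2nd ed. (2014), Thm. 1.5.3 [DeitmarEchterhoff2014].
* V. Platonov, A. Rapinchuk, *Algebraic Groups and Number Theory* (1994), §5.1 [PlatonovRapinchuk1994].
-/

noncomputable section

open MeasureTheory Measure NumberField IsDedekindDomain Topology
open Literature.MeasureTheory.Group
open Literature.AlgebraicGeometry.ShimuraVarieties (hermForm)
open scoped Matrix MatrixGroups NNReal

namespace Literature.NumberTheory.Automorphic

namespace UnitaryGroup

variable (L : Type) [Field L] [NumberField L] [IsCMField L] {N : ℕ} (H : Matrix (Fin N) (Fin N) L)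
  (v : HeightOneSpectrum (𝓞 ↥(maximalRealSubfield L)))
  [MeasurableSpace ((cmDatum L N H).Local v)] [BorelSpace ((cmDatum L N H).Local v)]

/-- **The FAMILY of local orbital measures of an ANISOTROPIC `U(H)` at ALL rational classes** (every rank, every finite `v`): `m : OrbitalMeasureFamily (U(H)(L⁺_v))`
with `m_c ≠ 0`, `U(H)(L⁺_v)`-invariant, regular and finite on compact sets at every class `c` of `U(H)(L⁺_v)` containing `toLocal v (γ ⊗ 1)` for some rational
`γ ∈ U(H)(L⁺)` — regular, central and singular `γ` alike, no semisimplicity asked. [cite: Rogawski1990, §4.9 p. 54; §14.2 p. 232] [cite: DeitmarEchterhoff2014, Thm. 1.5.3] -/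
theorem exists_localOrbitalMeasureFamily_of_anisotropic (hanis : ∀ x : Fin N → L, hermForm (cmConjRingHom L) H x x = 0 → x = 0)
    [∀ g : (cmDatum L N H).Local v,
      MeasurableSpace (((cmDatum L N H).Local v) ⧸ Subgroup.centralizer ({g} : Set ((cmDatum L N H).Local v)))]
    [∀ g : (cmDatum L N H).Local v,
      BorelSpace (((cmDatum L N H).Local v) ⧸ Subgroup.centralizer ({g} : Set ((cmDatum L N H).Local v)))] :
    ∃ m : OrbitalMeasureFamily ((cmDatum L N H).Local v), ∀ c : ConjClasses ((cmDatum L N H).Local v),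
      (∃ γ : (cmDatum L N H).Rational, ConjClasses.mk ((cmDatum L N H).toLocal v ((cmDatum L N H).toAdelic γ)) = c) →
        m c ≠ 0 ∧
          SMulInvariantMeasure ((cmDatum L N H).Local v)
            (((cmDatum L N H).Local v) ⧸ Subgroup.centralizer ({(Quotient.out c : (cmDatum L N H).Local v)} :
              Set ((cmDatum L N H).Local v))) (m c) ∧
          (m c).Regular ∧ IsFiniteMeasureOnCompacts (m c) := by
  borelize (cmDatum L N H).Adelic
  have hP : ∀ g : (cmDatum L N H).Local v,
      (∃ γ : (cmDatum L N H).Rational, IsConj ((cmDatum L N H).toLocal v ((cmDatum L N H).toAdelic γ)) g) →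
        ∀ (ρ : Measure (Subgroup.centralizer ({g} : Set ((cmDatum L N H).Local v)))) [ρ.IsHaarMeasure], ρ.IsMulRightInvariant := by
    rintro g ⟨γ, hc⟩ ρ _
    exact isMulRightInvariant_centralizer_of_isConj hc
      (fun ρ' _ => isMulRightInvariant_local_centralizer_toLocal_of_anisotropic L H v hanis γ ρ') ρ
  obtain ⟨m, hm⟩ := exists_orbitalMeasureFamily_of_isMulRightInvariant
    (fun g => modularCharacter_cmDatum_local_eq_one_of_anisotropic' L H v hanis g) _ hP
  refine ⟨m, fun c ⟨γ, hc⟩ => hm c ⟨γ, ?_⟩⟩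
  rw [← ConjClasses.mk_eq_mk_iff_isConj, hc, ← ConjClasses.quotient_mk_eq_mk, Quotient.out_eq]

/-- **Local orbital measure at `γ_v = toLocal v (γ ⊗ 1)`, `γ` rational, `H` anisotropic (every rank), with the quotient integral formula**: for any Haar
`ν` on `G = U(H)(L⁺_v)` and ANY Haar measure `ρ` on the centraliser `G_{γ_v}` (unimodular: ★ `isMulRightInvariant_local_centralizer_toLocal_of_anisotropic`, so `ρ`
is inversion invariant), there is a `G`-invariant REGULAR `m ≠ 0` on `G ⧸ G_{γ_v}` with `∫_{G ⧸ G_{γ_v}} ∫_{G_{γ_v}} f(x h) dρ dm = ∫_G f dν` for all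
`f ∈ C_c(G, ℝ)` (★ `exists_smulInvariantMeasure_quotient_centralizer`; the sharper form of ★ `exists_localOrbitalMeasure_toLocal_of_anisotropic`).
[cite: Rogawski1990, §4.9 p. 54] [cite: DeitmarEchterhoff2014, Thm. 1.5.3] -/
theorem exists_localOrbitalMeasure_toLocal_of_anisotropic' (hanis : ∀ x : Fin N → L, hermForm (cmConjRingHom L) H x x = 0 → x = 0)
    (γ : (cmDatum L N H).Rational) (ν : Measure ((cmDatum L N H).Local v)) [ν.IsHaarMeasure]
    (ρ : Measure (Subgroup.centralizer ({(cmDatum L N H).toLocal v ((cmDatum L N H).toAdelic γ)} : Set ((cmDatum L N H).Local v))))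
    [ρ.IsHaarMeasure]
    [MeasurableSpace ((cmDatum L N H).Local v ⧸
      Subgroup.centralizer ({(cmDatum L N H).toLocal v ((cmDatum L N H).toAdelic γ)} : Set ((cmDatum L N H).Local v)))]
    [BorelSpace ((cmDatum L N H).Local v ⧸
      Subgroup.centralizer ({(cmDatum L N H).toLocal v ((cmDatum L N H).toAdelic γ)} : Set ((cmDatum L N H).Local v)))] :
    ∃ m : Measure ((cmDatum L N H).Local v ⧸
        Subgroup.centralizer ({(cmDatum L N H).toLocal v ((cmDatum L N H).toAdelic γ)} : Set ((cmDatum L N H).Local v))),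
      SMulInvariantMeasure ((cmDatum L N H).Local v) _ m ∧ m.Regular ∧ m ≠ 0 ∧
        ∀ f : CompactlySupportedContinuousMap ((cmDatum L N H).Local v) ℝ,
          ∫ x, fiberIntegral (Subgroup.centralizer ({(cmDatum L N H).toLocal v ((cmDatum L N H).toAdelic γ)} : Set ((cmDatum L N H).Local v)))
            ρ f x ∂m = ∫ g, f g ∂ν := by
  borelize (cmDatum L N H).Adelic
  haveI : ν.IsMulRightInvariant :=
    isMulRightInvariant_cmDatum_local_of_adelic L H v (modularCharacter_cmDatum_eq_one_of_anisotropic L H hanis) ν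
  haveI : LocallyCompactSpace (Subgroup.centralizer ({(cmDatum L N H).toLocal v ((cmDatum L N H).toAdelic γ)} : Set ((cmDatum L N H).Local v))) :=
    (isClosed_coe_centralizer_singleton _).isClosedEmbedding_subtypeVal.locallyCompactSpace
  haveI : SecondCountableTopology (Subgroup.centralizer ({(cmDatum L N H).toLocal v ((cmDatum L N H).toAdelic γ)} :
      Set ((cmDatum L N H).Local v))) := TopologicalSpace.Subtype.secondCountableTopology _
  haveI : ρ.IsMulRightInvariant := isMulRightInvariant_local_centralizer_toLocal_of_anisotropic L H v hanis γ ρ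
  haveI : ρ.IsInvInvariant := isInvInvariant_of_isMulRightInvariant _
  exact exists_smulInvariantMeasure_quotient_centralizer ((cmDatum L N H).toLocal v ((cmDatum L N H).toAdelic γ)) ν ρ

end UnitaryGroup

end Literature.NumberTheory.Automorphic
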